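import Mathlib
import Summits.AtomisticToContinuum.BoseEinsteinCondensation.Theorems.SoloBlindPairingSqueeze

/-!
# Door 4, session-9 audit: the exact pairing squeeze, the bare infrared squeeze, and the
# vacuity of a uniform vertex bound (real-arithmetic skeleton of paper §13.7)

Notation as in `SoloBlindPairingSqueeze`: for the torus ground state and `k ≠ 0`,
`n = n_k`, `P = ⟨a_k† a†_{-k} a_0 a_0⟩`, `q = ⟨n_0(n_0-1)(n_k+1)⟩`, `m = ⟨n_k n_0⟩`,
`c = v̂(k)/V ≥ 0`, `H = v̂(0)(N-1)/V`, `μ = E_N - E_{N-1}`.  The interaction part of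
`-⟨a_k†[V,a_k]⟩` is partitioned exactly as `W = H n + F₀ + F₁ + c P + R` with
`F₀ = c m` the soft Fock term (`q = k`, `s = k`), `F₁ ≥ 0` the remaining Fock terms and `R` the
vertex remainder (at most one condensate leg).  Perturbative positivity reads `ε n + W ≤ μ n`,
with slack `S = μ n - ε n - W ≥ 0`.

* `pairing_squeeze_exact` (Theorem 13.3′): **without** the trial-state input `μ ≤ H`,
  `ε n ≤ c (√(n q) - m) - R'` where `R' := R + (H - μ) n + F₁` is the *renormalised* remainder.
  Theorem 13.3 threw away the Hartree slack `(H - μ) n ≥ 0`; in the thermodynamic limit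
  `H - μ → (v̂(0) - 8πa(1+o(1))) ρ > 0`, so that slack is of the order of the leading terms.
* `bare_squeeze_of_renormalised_remainder`: the exact bookkeeping identity
  `ε n + (H-μ) n + F₀ + F₁ + c P + R + S = 0` shows that `R' + S ≥ 0` gives the
  **bare infrared squeeze** `ε n ≤ c (√(n q) - m)` (conjecture BIS of §13.7), and
  `ir_bound_of_bare_squeeze` turns it into `n ≤ c N₀ / (2 ε)` under zero-mode concentration.
* `occupation_le_of_uniform_vertex_bound` (Proposition 13.8, vacuity of (VD-b)): if the raw
  remainder obeyed `R ≥ -A` while `H - μ ≥ δ > 0`, then `n ≤ (A + c N₀/2)/δ` — a bound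
  *uniform in k*, incompatible with the `1/k` divergence of `n_k`; hence the remainder must carry
  the Hartree renormalisation and (VD-b) has to be re-typed with `R'`.
Pure real arithmetic; no second quantisation enters.
-/

namespace Summit.AtomisticToContinuum.BoseEinsteinCondensation.Theorems

/-- **Theorem 13.3′ (exact pairing squeeze).**  Perturbative positivity `ε n + W ≤ μ n` with the
exact partition `W = H n + F₀ + F₁ + c P + R`, the soft Fock identity `c m ≤ F₀`, `c ≥ 0` and the
Gram bound `P² ≤ n q` give `ε n ≤ c (√(n q) - m) - (R + (H - μ) n + F₁)`; no trial-state bound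
on `μ` is used. -/
theorem pairing_squeeze_exact (ε n W μ H F₀ F₁ P R c m q : ℝ)
    (hPP : ε * n + W ≤ μ * n) (hW : W = H * n + F₀ + F₁ + c * P + R)
    (hF : c * m ≤ F₀) (hc : 0 ≤ c) (hP : P ^ 2 ≤ n * q) :
    ε * n ≤ c * (Real.sqrt (n * q) - m) - (R + (H - μ) * n + F₁) := by
  have habs : |P| ≤ Real.sqrt (n * q) := by
    rw [← Real.sqrt_sq_eq_abs]
    exact Real.sqrt_le_sqrt hP
  have hPle : -P ≤ Real.sqrt (n * q) := le_trans (neg_le_abs P) habs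
  have hcP : c * (-P) ≤ c * Real.sqrt (n * q) := mul_le_mul_of_nonneg_left hPle hc
  have h0 : ε * n + H * n + F₀ + F₁ + c * P + R ≤ μ * n := by
    have := hPP; rw [hW] at this; linarith
  nlinarith [h0, hcP, hF]

/-- Theorem 13.3 is the special case of Theorem 13.3′ in which the Hartree slack `(H-μ) n ≥ 0`
and the hard Fock terms `F₁ ≥ 0` are discarded. -/
theorem pairing_squeeze_of_exact (ε n μ H F₁ R c m q : ℝ)
    (h : ε * n ≤ c * (Real.sqrt (n * q) - m) - (R + (H - μ) * n + F₁))
    (hμ : μ ≤ H) (hn : 0 ≤ n) (hF₁ : 0 ≤ F₁) :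
    ε * n ≤ c * (Real.sqrt (n * q) - m) - R := by
  have : 0 ≤ (H - μ) * n := mul_nonneg (by linarith) hn
  linarith

/-- **Bare infrared squeeze from the renormalised remainder (BIS, §13.7).**  The exact
bookkeeping identity of perturbative positivity,
`ε n + (H-μ) n + F₀ + F₁ + c P + R + S = 0` (`S ≥ 0` the PP slack), together with
`R' + S ≥ 0` for `R' = R + (H-μ) n + F₁`, gives `ε n ≤ c (√(n q) - m)`. -/
theorem bare_squeeze_of_renormalised_remainder (ε n μ H F₀ F₁ P R S c m q : ℝ)
    (hId : ε * n + (H - μ) * n + F₀ + F₁ + c * P + R + S = 0)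
    (hRS : 0 ≤ (R + (H - μ) * n + F₁) + S)
    (hF : c * m ≤ F₀) (hc : 0 ≤ c) (hP : P ^ 2 ≤ n * q) :
    ε * n ≤ c * (Real.sqrt (n * q) - m) := by
  have habs : |P| ≤ Real.sqrt (n * q) := by
    rw [← Real.sqrt_sq_eq_abs]
    exact Real.sqrt_le_sqrt hP
  have hPle : -P ≤ Real.sqrt (n * q) := le_trans (neg_le_abs P) habs
  have hcP : c * (-P) ≤ c * Real.sqrt (n * q) := mul_le_mul_of_nonneg_left hPle hc
  nlinarith [hId, hRS, hcP, hF]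

/-- Conversely the bare squeeze in its sharp form `ε n + F₀ + c P ≤ 0` *is* `R' + S ≥ 0`. -/
theorem renormalised_remainder_nonneg_iff (ε n μ H F₀ F₁ P R S c : ℝ)
    (hId : ε * n + (H - μ) * n + F₀ + F₁ + c * P + R + S = 0) :
    0 ≤ (R + (H - μ) * n + F₁) + S ↔ ε * n + F₀ + c * P ≤ 0 := by
  constructor <;> intro h <;> linarith

/-- **Infrared bound from the bare squeeze.**  Under zero-mode concentration at `N₀`
(`q ≤ N₀²(n+1)`, `m ≥ N₀ n`) the bare squeeze gives `ε n ≤ c N₀ / 2`, i.e.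
`n_k ≤ ρ₀ v̂(k) / (2 ε_k)` in the original variables. -/
theorem ir_bound_of_bare_squeeze (ε n c m q N₀ : ℝ)
    (hsq : ε * n ≤ c * (Real.sqrt (n * q) - m)) (hn : 0 ≤ n) (hc : 0 ≤ c) (hN : 0 ≤ N₀)
    (hq : q ≤ N₀ ^ 2 * (n + 1)) (hm : N₀ * n ≤ m) (hε : 0 < ε) :
    n ≤ c * N₀ / 2 / ε := by
  have h0 : ε * n ≤ c * (Real.sqrt (n * q) - m) - 0 := by linarith
  have h1 := pairing_squeeze_of_concentration ε n 0 c m q N₀ h0 hn hc hN hq hm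
  rw [le_div_iff₀ hε]
  linarith

/-- **Proposition 13.8 (vacuity of a uniform bound on the raw remainder).**  If perturbative
positivity holds with the exact partition, the zero mode is concentrated at `N₀`, the Hartree gap
is `H - μ ≥ δ > 0`, `ε ≥ 0`, and the *raw* vertex remainder satisfied `R ≥ -A`, then
`n ≤ (A + c N₀ / 2) / δ`, uniformly in the mode.  In the dilute Bose gas `δ ≈ (v̂(0) - 8πa) ρ` is
of order one while `n_k → ∞` as `k → 0`, so `R ≥ -A` cannot hold uniformly: the remainder
carries the Hartree renormalisation `-(H-μ) n (1+o(1))`. -/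
theorem occupation_le_of_uniform_vertex_bound (ε n W μ H F₀ F₁ P R c m q N₀ A δ : ℝ)
    (hPP : ε * n + W ≤ μ * n) (hW : W = H * n + F₀ + F₁ + c * P + R)
    (hF : c * m ≤ F₀) (hF₁ : 0 ≤ F₁) (hc : 0 ≤ c) (hn : 0 ≤ n) (hε : 0 ≤ ε)
    (hP : P ^ 2 ≤ n * q) (hN : 0 ≤ N₀) (hq : q ≤ N₀ ^ 2 * (n + 1)) (hm : N₀ * n ≤ m)
    (hδ : δ ≤ H - μ) (hδ0 : 0 < δ) (hR : -A ≤ R) :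
    n ≤ (A + c * N₀ / 2) / δ := by
  have h1 := pairing_squeeze_exact ε n W μ H F₀ F₁ P R c m q hPP hW hF hc hP
  have h2 := pairing_squeeze_of_concentration ε n (R + (H - μ) * n + F₁) c m q N₀ h1 hn hc hN hq hm
  -- h2 : ε n ≤ c N₀ / 2 - (R + (H-μ) n + F₁)
  have h3 : (H - μ) * n ≤ c * N₀ / 2 + A := by nlinarith [mul_nonneg hε hn]
  have h4 : δ * n ≤ (H - μ) * n := mul_le_mul_of_nonneg_right hδ hn
  rw [le_div_iff₀ hδ0]
  linarith

/-- The contrapositive used in §13.7: a mode whose occupation exceeds `(A + c N₀/2)/δ` violates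
the raw vertex bound `R ≥ -A` (all other inputs being exact). -/
theorem vertex_bound_fails_of_large_occupation (ε n W μ H F₀ F₁ P R c m q N₀ A δ : ℝ)
    (hPP : ε * n + W ≤ μ * n) (hW : W = H * n + F₀ + F₁ + c * P + R)
    (hF : c * m ≤ F₀) (hF₁ : 0 ≤ F₁) (hc : 0 ≤ c) (hn : 0 ≤ n) (hε : 0 ≤ ε)
    (hP : P ^ 2 ≤ n * q) (hN : 0 ≤ N₀) (hq : q ≤ N₀ ^ 2 * (n + 1)) (hm : N₀ * n ≤ m)
    (hδ : δ ≤ H - μ) (hδ0 : 0 < δ) (hbig : (A + c * N₀ / 2) / δ < n) :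
    R < -A := by
  by_contra hR
  have := occupation_le_of_uniform_vertex_bound ε n W μ H F₀ F₁ P R c m q N₀ A δ
    hPP hW hF hF₁ hc hn hε hP hN hq hm hδ hδ0 (not_lt.mp hR)
  linarith

end Summit.AtomisticToContinuum.BoseEinsteinCondensation.Theorems
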